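import Summits.QuantumFields.YangMills.Theorems.ColdStartUniversalityLatticeLangevinBatchCovariance
import Summits.QuantumFields.YangMills.Theorems.ColdStartUniversalityLatticeLangevinAsymptoticVariancePositive
import Mathlib.LinearAlgebra.Matrix.PosDef
import HarnessLib

/-!
# Route `ColdStartUniversality` (fixed-cut-off SZZ dynamics, sampler package): ★★ the Green–Kubo covariance matrix is POSITIVE DEFINITE for
# linearly independent observables — non-degeneracy of the multivariate CLT and of the delta-method variance

Helper file (seat `ym-line-csu-p1`, g35; `--supports stmt-QuantumFields-24809`).  For finitely many continuous observables `|Gᵢ| ≤ 1` whose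
non-trivial linear combinations are all non-constant (`∀ a ≠ 0, ∃ y₁ y₂, Σ aᵢGᵢ(y₁) ≠ Σ aᵢGᵢ(y₂)`), the Green–Kubo covariance matrix `S` of file 99b is
symmetric (`isHermitian_greenKuboMatrix`) and POSITIVE DEFINITE (★★ `posDef_greenKuboMatrix`): `aᵀSa = σ²(Σ aᵢGᵢ) > 0` by bilinearity (105b) and
the positivity of the asymptotic variance of every non-constant continuous observable (98, reversibility + continuity of `t ↦ κ_t` at `0`).  In
particular the variance `∇h(m)ᵀS∇h(m)` of the delta method (103–105c) is positive as soon as `∇h(m) ≠ 0` (`dotProduct_mulVec_greenKubo_pos`).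
THEOREMS ONLY, no definition, no sorry; [folklore].
HONEST FRAMING: fixed cut-off; `S` depends on `L, β'`; `UniformColdStartMixing` (24809) is NOT restated; no crux, rung or summit statement is
proved; the Yang–Mills mass gap is NOT proved.
-/

set_option autoImplicit false

noncomputable section

namespace Summit.QuantumFields.YangMills.Theorems.ColdStartUniversality

open MeasureTheory ProbabilityTheory Filter Topology Set Matrix
open scoped NNReal ENNReal BigOperators
open Literature Literature.Probability.Process Literature.MathematicalPhysics.QuantumFieldTheory
open Literature.MathematicalPhysics.QuantumLattice (fundamentalRep fundamentalLatticeRep continuous_fundamentalRep)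

variable {L : ℕ} [NeZero L]

/-- The Green–Kubo covariance matrix is symmetric. [folklore] -/
theorem isHermitian_greenKuboMatrix (L : ℕ) [NeZero L] (β' : ℝ)
    (κ : ℝ≥0 → Kernel (GaugeConfig 3 L (Matrix.specialUnitaryGroup (Fin 2) ℂ))
      (GaugeConfig 3 L (Matrix.specialUnitaryGroup (Fin 2) ℂ))) {ι : Type}
    {G : ι → GaugeConfig 3 L (Matrix.specialUnitaryGroup (Fin 2) ℂ) → ℝ} {S : Matrix ι ι ℝ}
    (hS : S = fun i j => ∫ t in Ioi (0 : ℝ),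
      (∫ y, ((G i y - ∫ z, G i z ∂(wilsonMeasure (d := 3) (L := L) (fundamentalRep (Fin 2)) β')) *
          (∫ z, (G j z - ∫ z', G j z' ∂(wilsonMeasure (d := 3) (L := L) (fundamentalRep (Fin 2)) β')) ∂(κ t.toNNReal y)) +
        (G j y - ∫ z, G j z ∂(wilsonMeasure (d := 3) (L := L) (fundamentalRep (Fin 2)) β')) *
          (∫ z, (G i z - ∫ z', G i z' ∂(wilsonMeasure (d := 3) (L := L) (fundamentalRep (Fin 2)) β')) ∂(κ t.toNNReal y)))
        ∂(wilsonMeasure (d := 3) (L := L) (fundamentalRep (Fin 2)) β'))) :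
    S.IsHermitian := by
  ext i j
  rw [Matrix.conjTranspose_apply, star_trivial, hS]
  exact integral_congr_ae (ae_of_all _ fun t => integral_congr_ae (ae_of_all _ fun y => by ring))

/-- ★★ The quadratic form of the Green–Kubo matrix is positive at every `a ≠ 0` for which `Σ aᵢGᵢ` is non-constant. [folklore] -/
theorem dotProduct_mulVec_greenKubo_pos (L : ℕ) [NeZero L] (β' : ℝ)
    (κ : ℝ≥0 → Kernel (GaugeConfig 3 L (Matrix.specialUnitaryGroup (Fin 2) ℂ))
      (GaugeConfig 3 L (Matrix.specialUnitaryGroup (Fin 2) ℂ))) [∀ t, IsMarkovKernel (κ t)]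
    (hreal : ∀ (t : ℝ≥0) (x : GaugeConfig 3 L (Matrix.specialUnitaryGroup (Fin 2) ℂ))
        (Ω : Type) [MeasurableSpace Ω] (P : Measure Ω) [IsProbabilityMeasure P]
        (W : ℝ≥0 → Ω → (Edge 3 L × NoiseIdx 2 → ℝ)) (hW : IsFlatBrownian W P)
        (U : ℝ≥0 → Ω → GaugeConfig 3 L (Matrix.specialUnitaryGroup (Fin 2) ℂ)),
        (∀ ω, U 0 ω = x) →
        (latticeLangevinDynamics (fundamentalLatticeRep 2) β').IsSolution (fundamentalRep (Fin 2))
          hW.natFiltration P W U →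
        κ t x = P.map (U t))
    {ι : Type} [Fintype ι]
    {G : ι → GaugeConfig 3 L (Matrix.specialUnitaryGroup (Fin 2) ℂ) → ℝ} (hGc : ∀ i, Continuous (G i)) (hG1 : ∀ i z, |G i z| ≤ 1)
    {S : Matrix ι ι ℝ}
    (hS : S = fun i j => ∫ t in Ioi (0 : ℝ),
      (∫ y, ((G i y - ∫ z, G i z ∂(wilsonMeasure (d := 3) (L := L) (fundamentalRep (Fin 2)) β')) *
          (∫ z, (G j z - ∫ z', G j z' ∂(wilsonMeasure (d := 3) (L := L) (fundamentalRep (Fin 2)) β')) ∂(κ t.toNNReal y)) +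
        (G j y - ∫ z, G j z ∂(wilsonMeasure (d := 3) (L := L) (fundamentalRep (Fin 2)) β')) *
          (∫ z, (G i z - ∫ z', G i z' ∂(wilsonMeasure (d := 3) (L := L) (fundamentalRep (Fin 2)) β')) ∂(κ t.toNNReal y)))
        ∂(wilsonMeasure (d := 3) (L := L) (fundamentalRep (Fin 2)) β')))
    (a : ι → ℝ) {y₁ y₂ : GaugeConfig 3 L (Matrix.specialUnitaryGroup (Fin 2) ℂ)} (hne : ∑ i, a i * G i y₁ ≠ ∑ i, a i * G i y₂) :
    0 < a ⬝ᵥ S *ᵥ a := by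
  rw [dotProduct_mulVec_greenKubo_eq L β' κ hreal hGc hG1 hS a]
  have hGac : Continuous fun z => ∑ i, a i * G i z := continuous_finsetSum _ fun i _ => continuous_const.mul (hGc i)
  have hGab : ∀ z, |∑ i, a i * G i z| ≤ ∑ i, |a i| := fun z =>
    (Finset.abs_sum_le_sum_abs _ _).trans (Finset.sum_le_sum fun i _ => by
      rw [abs_mul]
      calc |a i| * |G i z| ≤ |a i| * 1 := mul_le_mul_of_nonneg_left (hG1 i z) (abs_nonneg _)
        _ = |a i| := mul_one _)
  exact greenKubo_pos_of_ne L β' κ hreal hGac hGab hne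

/-- ★★ **The Green–Kubo covariance matrix is positive definite** when every non-trivial linear combination of the observables is non-constant
(fixed cut-off; every coupling). [folklore] -/
theorem posDef_greenKuboMatrix (L : ℕ) [NeZero L] (β' : ℝ)
    (κ : ℝ≥0 → Kernel (GaugeConfig 3 L (Matrix.specialUnitaryGroup (Fin 2) ℂ))
      (GaugeConfig 3 L (Matrix.specialUnitaryGroup (Fin 2) ℂ))) [∀ t, IsMarkovKernel (κ t)]
    (hreal : ∀ (t : ℝ≥0) (x : GaugeConfig 3 L (Matrix.specialUnitaryGroup (Fin 2) ℂ))
        (Ω : Type) [MeasurableSpace Ω] (P : Measure Ω) [IsProbabilityMeasure P]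
        (W : ℝ≥0 → Ω → (Edge 3 L × NoiseIdx 2 → ℝ)) (hW : IsFlatBrownian W P)
        (U : ℝ≥0 → Ω → GaugeConfig 3 L (Matrix.specialUnitaryGroup (Fin 2) ℂ)),
        (∀ ω, U 0 ω = x) →
        (latticeLangevinDynamics (fundamentalLatticeRep 2) β').IsSolution (fundamentalRep (Fin 2))
          hW.natFiltration P W U →
        κ t x = P.map (U t))
    {ι : Type} [Fintype ι]
    {G : ι → GaugeConfig 3 L (Matrix.specialUnitaryGroup (Fin 2) ℂ) → ℝ} (hGc : ∀ i, Continuous (G i)) (hG1 : ∀ i z, |G i z| ≤ 1)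
    {S : Matrix ι ι ℝ}
    (hS : S = fun i j => ∫ t in Ioi (0 : ℝ),
      (∫ y, ((G i y - ∫ z, G i z ∂(wilsonMeasure (d := 3) (L := L) (fundamentalRep (Fin 2)) β')) *
          (∫ z, (G j z - ∫ z', G j z' ∂(wilsonMeasure (d := 3) (L := L) (fundamentalRep (Fin 2)) β')) ∂(κ t.toNNReal y)) +
        (G j y - ∫ z, G j z ∂(wilsonMeasure (d := 3) (L := L) (fundamentalRep (Fin 2)) β')) *
          (∫ z, (G i z - ∫ z', G i z' ∂(wilsonMeasure (d := 3) (L := L) (fundamentalRep (Fin 2)) β')) ∂(κ t.toNNReal y)))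
        ∂(wilsonMeasure (d := 3) (L := L) (fundamentalRep (Fin 2)) β')))
    (hind : ∀ a : ι → ℝ, a ≠ 0 → ∃ y₁ y₂ : GaugeConfig 3 L (Matrix.specialUnitaryGroup (Fin 2) ℂ), ∑ i, a i * G i y₁ ≠ ∑ i, a i * G i y₂) :
    S.PosDef := by
  refine Matrix.PosDef.of_dotProduct_mulVec_pos (isHermitian_greenKuboMatrix L β' κ hS) fun a ha => ?_
  rw [star_trivial]
  obtain ⟨y₁, y₂, hne⟩ := hind a ha
  exact dotProduct_mulVec_greenKubo_pos L β' κ hreal hGc hG1 hS a hne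

end Summit.QuantumFields.YangMills.Theorems.ColdStartUniversality

end
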